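/-
Copyright: the b2b-balaban T⁴-continuum CRUX team, row NE7b owner lineage `t4-ne7b-p1` (gen 112). Project licence.
-/
import Summits.QuantumFields.BalabanUV.T4Continuum.Spine.NE7b.OneShotChartBound

/-!
# THE ONE-SHOT CHART, PARAMETRIC FIBRE CHAIN: the fibre ratio is at most `1∕X(p′)` with the FULL alias sum `X = Σ_k U_kR_k`
# (`Σ_τ‖G_τ‖² ≤ N^d·symbR²∕X`), and ANY fibre bound `Σ_τ‖G_τ(p′)‖² ≤ (n+1)^d·K·symbR(p′)²` on the zone yields
# `Σ′_z (H B)(z)² ≤ (n+1)^d·K·Σ′_y B(y)²` for every square-summable `B` — (42)'s Bessel chain with the constant as a parameter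
# (row NE7b, node U5c; Literature B4∕B5∕B6 columns + Mathlib + (39)–(42); [folklore])

Cell `pub-balaban`, sub-cell `t4`, spine estimate NE7b (`T4WeightBudget.RelWeightBound`; the cell's OWN estimate — NOT PRINTED in
[Bałaban 1983–89], NOT PROVED).  Crux-route work under `Spine/NE7b/` by the row OWNER (`t4-ne7b-p1` gen 112) under FREEZE (0)'s
crux-prover clause (RULING W-ne7bp1-g112-1); NOTHING of Bałaban's is asserted; no `T4Continuum/Support` leaf typed; no `def`; zero `sorry`.

WHY.  (42) `OneShotChartBound` hardwires the constant `(π²∕4)^d` of (39)∕(40) (central alias only).  Sharper fibre bounds — the near-central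
alias pair at block side `2` (`OneShotChartSideTwo`), a calculus certificate at side `4`, or a certified enclosure — all enter the SAME chain
(block rows of `H B` are Fourier coefficients of `(G_τ∕symbQGQ)·B̂`, Bessel per row, the fibre bound under the integral, `(2π)^{−d}∫|B̂|² =
Σ B²`, exhaustion of `ℤ^d`); this file states the chain once with the constant `K` as a hypothesis, and records the first improvement
common to all of them: since `R_k ≤ 1` ((40) `Rr_le_one`), `Σ_k U_kR_k² ≤ X`, so the fibre ratio `S₂∕S²` is at most `1∕X(p′)` — every
alias kept, instead of `1∕U_0(p′)`.

WHAT IS PROVED ([folklore]; `N ≥ 1`, `a > 0`, `p ∈ [−π,π]^d`):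
* §1 `sum_Ur_mul_Rr_sq_le_Xr` (`Σ_k U_kR_k² ≤ X`), **`sum_normSq_G_le_div_Xr`** (`Σ_τ ‖G_{N,a,0,τ}(p)‖² ≤ N^d symbR(p)²∕X(p)`).
* §2 `integrand_sum_le_of_fibre`, `tsum_HB_sq_le_of_fibre` (finite windows), **`tsum_HBZd_sq_le_of_fibre`**: a fibre bound with constant
  `K` on the zone gives `Σ′_z (H B)(z)² ≤ (n+1)^d·K·Σ′_y B(y)²` for every square-summable `B`.

NOT HERE (honest): any specific constant (see (42) for `(π²∕4)^d`, `OneShotChartSideTwo` for block side `2`); anything of Bałaban's ((A3),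
NC-NE7b-α UNRULED).  BY-NAME EFFECT ON THE WALL: NONE.  NE7b NOT PRINTED ∕ NOT PROVED; spine PROVED 0∕9; rung (B)+1 on a FINITE torus — NOT
infinite volume, NOT the mass gap, NOT Clay.  HONEST DEPENDENCY: continuum YM on T⁴ ⇐ BetaPertH ∧ nine spine estimates (0∕9 proved);
BetaPertH ⇐ (D1) ∧ (D4) ∧ CAP+tail.
-/

set_option autoImplicit false

namespace Summit.QuantumFields.BalabanUV.T4Continuum.NE7b.OneShotChartFibreChain

open Finset Complex MeasureTheory Filter Topology
open Literature.MathematicalPhysics.QuantumFieldTheory.Balaban1983to89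
open B4Strip (ofRealVec Ur Er Ur_nonneg)
open B4StripSums (G)
open B4ContourShift (BZ latticeKernel)
open B4Green244 (phaseC)
open B6QGQLower276 (X B blk chart)
open B5Hk103ScalarZd (kerH tsum_blocks)
open B5Hk103Minimizer (HB)
open B5Hk165L2Zd (HBZd summable_HBZd_row summable_HBZd_sq)
open B5Momentum166Zd (FTsq integral_FTsq continuous_FTsq isCompact_BZ measurableSet_BZ FTsq_nonneg)
open B6QGQFourier275Zd (symbQGQ symbQGQ_ofReal symbR Rr Xr symbR_ge twoGamma0_pos Rr_nonneg Xr_ge sum_B_eq)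
open OneShotChartFibreSum (sum_normSq_G Rr_le_one symbR_eq_div Er_pos)
open OneShotChartBound (norm_Bhat_sq continuousOn_rowMult tsum_row_sq_le tendsto_sum_HB_sq)
open scoped Real

noncomputable section

variable {d : ℕ}

/-! ## §1. The fibre ratio is at most `1∕X(p′)` with the full alias sum -/

/-- `Σ_k U_k R_k² ≤ Σ_k U_k R_k = X` on the zone (`0 ≤ R_k ≤ 1`, `U_k ≥ 0`). [folklore] -/
theorem sum_Ur_mul_Rr_sq_le_Xr (N : ℕ) [NeZero N] (p : Fin d → ℝ) (hp : p ∈ BZ d) :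
    ∑ k : Fin d → Fin N, Ur N k p * Rr N k p ^ 2 ≤ Xr N p := by
  unfold Xr
  refine Finset.sum_le_sum fun k _ => mul_le_mul_of_nonneg_left ?_ (Ur_nonneg N k p)
  have h0 := Rr_nonneg N k p
  have h1 := Rr_le_one N k p hp
  nlinarith

/-- **`Σ_τ ‖G_{N,a,0,τ}(p)‖² ≤ N^d · symbR(p)² ∕ X(p)`**: the fibre ratio `S₂∕S²` is at most `1∕X(p′)` (every alias kept in `X`). [folklore] -/
theorem sum_normSq_G_le_div_Xr (N : ℕ) [NeZero N] (hN : 1 ≤ N) {a : ℝ} (ha : 0 < a) (p : Fin d → ℝ) (hp : p ∈ BZ d) :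
    ∑ τ : Fin d → Fin N, ‖G N a 0 τ (ofRealVec p)‖ ^ 2 ≤ (N : ℝ) ^ d * (symbR N a p ^ 2 / Xr N p) := by
  have hX : 0 < Xr N p := lt_of_lt_of_le (by positivity) (Xr_ge N hN p fun μ => abs_le.mpr ⟨hp.1 μ, hp.2 μ⟩)
  have hE : 0 < Er N a 0 p := Er_pos N hN ha p hp
  rw [sum_normSq_G N hN a p hp, symbR_eq_div, mul_div_assoc]
  refine mul_le_mul_of_nonneg_left ?_ (by positivity)
  rw [div_pow, div_div, div_le_div_iff₀ (by positivity) (by positivity)]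
  have h := sum_Ur_mul_Rr_sq_le_Xr N p hp
  have h2 : 0 ≤ Er N a 0 p ^ 2 * Xr N p := by positivity
  nlinarith

/-! ## §2. The parametric Bessel chain: a fibre bound with constant `K` gives `‖H‖² ≤ K` -/

/-- the fibre hypothesis under the integral: `Σ_τ ‖(G_τ∕symbQGQ)(p)·B̂_T(p)‖² ≤ (n+1)^d K ‖B̂_T(p)‖²`. [folklore] -/
theorem integrand_sum_le_of_fibre (n : ℕ) {a : ℝ} (ha : 0 < a) {K : ℝ}
    (hK : ∀ p ∈ BZ d, ∑ τ : Fin d → Fin (n + 1), ‖G (n + 1) a 0 τ (ofRealVec p)‖ ^ 2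
      ≤ ((n : ℝ) + 1) ^ d * K * symbR (n + 1) a p ^ 2)
    (T : Finset (X d)) (Bf : X d → ℝ) (p : Fin d → ℝ) (hp : p ∈ BZ d) :
    ∑ τ : Fin d → Fin (n + 1), ‖G (n + 1) a 0 τ (ofRealVec p) / symbQGQ (n + 1) a (ofRealVec p)
        * ∑ y ∈ T, (Bf y : ℂ) * cexp (I * phaseC (ofRealVec p) (-y))‖ ^ 2
      ≤ ((n : ℝ) + 1) ^ d * K * FTsq T Bf p := by
  have hs : 0 < symbR (n + 1) a p := lt_of_lt_of_le (twoGamma0_pos d ha) (symbR_ge (n + 1) (by omega) ha p hp)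
  have h1 : ∀ τ : Fin d → Fin (n + 1), ‖G (n + 1) a 0 τ (ofRealVec p) / symbQGQ (n + 1) a (ofRealVec p)
        * ∑ y ∈ T, (Bf y : ℂ) * cexp (I * phaseC (ofRealVec p) (-y))‖ ^ 2
      = ‖G (n + 1) a 0 τ (ofRealVec p)‖ ^ 2 * (FTsq T Bf p / symbR (n + 1) a p ^ 2) := fun τ => by
    rw [norm_mul, norm_div, mul_pow, div_pow, norm_Bhat_sq, symbQGQ_ofReal, Complex.norm_real, Real.norm_eq_abs, sq_abs]
    ring
  simp_rw [h1]
  rw [← Finset.sum_mul]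
  have hF : 0 ≤ FTsq T Bf p := FTsq_nonneg T Bf p
  calc (∑ τ : Fin d → Fin (n + 1), ‖G (n + 1) a 0 τ (ofRealVec p)‖ ^ 2) * (FTsq T Bf p / symbR (n + 1) a p ^ 2)
      ≤ (((n : ℝ) + 1) ^ d * K * symbR (n + 1) a p ^ 2) * (FTsq T Bf p / symbR (n + 1) a p ^ 2) :=
        mul_le_mul_of_nonneg_right (hK p hp) (by positivity)
    _ = ((n : ℝ) + 1) ^ d * K * FTsq T Bf p := by field_simp

/-- **the parametric chain, finite window**: `Σ′_z (Σ_{y∈T}B(y)H(z,y))² ≤ (n+1)^d·K·Σ_{y∈T}B(y)²`. [folklore] -/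
theorem tsum_HB_sq_le_of_fibre (n : ℕ) {a : ℝ} (ha : 0 < a) {K : ℝ}
    (hK : ∀ p ∈ BZ d, ∑ τ : Fin d → Fin (n + 1), ‖G (n + 1) a 0 τ (ofRealVec p)‖ ^ 2
      ≤ ((n : ℝ) + 1) ^ d * K * symbR (n + 1) a p ^ 2)
    (T : Finset (X d)) (Bf : X d → ℝ) :
    (Summable fun z : X d => HB n a T Bf z ^ 2) ∧
      ∑' z : X d, HB n a T Bf z ^ 2 ≤ ((n : ℝ) + 1) ^ d * K * ∑ y ∈ T, Bf y ^ 2 := by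
  have hrow := fun τ => tsum_row_sq_le n ha T Bf τ
  have hS : Summable fun z : X d => HB n a T Bf z ^ 2 := (OneShotChartBound.tsum_HB_sq_le_sharp n ha T Bf).1
  refine ⟨hS, ?_⟩
  set g : (Fin d → Fin (n + 1)) → (Fin d → ℝ) → ℝ := fun τ p =>
    ‖G (n + 1) a 0 τ (ofRealVec p) / symbQGQ (n + 1) a (ofRealVec p)
      * ∑ y ∈ T, (Bf y : ℂ) * cexp (I * phaseC (ofRealVec p) (-y))‖ ^ 2 with hg
  have hgc : ∀ τ, ContinuousOn (g τ) (BZ d) := fun τ => by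
    simp only [hg]
    exact (continuousOn_rowMult n ha τ T Bf).norm.pow 2
  have hgi : ∀ τ, IntegrableOn (g τ) (BZ d) := fun τ => (hgc τ).integrableOn_compact isCompact_BZ
  have hmaj : IntegrableOn (fun p => ((n : ℝ) + 1) ^ d * K * FTsq T Bf p) (BZ d) :=
    ((continuous_FTsq T Bf).continuousOn.integrableOn_compact isCompact_BZ).const_mul _
  calc ∑' z : X d, HB n a T Bf z ^ 2
      = ∑' x : X d, ∑ q ∈ B n x, HB n a T Bf q ^ 2 := (tsum_blocks n hS).symm
    _ = ∑' x : X d, ∑ τ : Fin d → Fin (n + 1), HB n a T Bf (chart n x τ) ^ 2 :=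
        tsum_congr fun x => sum_B_eq n x _
    _ = ∑ τ : Fin d → Fin (n + 1), ∑' x : X d, HB n a T Bf (chart n x τ) ^ 2 :=
        Summable.tsum_finsetSum fun τ _ => (hrow τ).1
    _ ≤ ∑ τ : Fin d → Fin (n + 1), ((2 * π) ^ d)⁻¹ * ∫ p in BZ d, g τ p :=
        Finset.sum_le_sum fun τ _ => (hrow τ).2
    _ = ((2 * π) ^ d)⁻¹ * ∫ p in BZ d, ∑ τ : Fin d → Fin (n + 1), g τ p := by
        rw [← Finset.mul_sum, integral_finsetSum _ fun τ _ => hgi τ]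
    _ ≤ ((2 * π) ^ d)⁻¹ * ∫ p in BZ d, ((n : ℝ) + 1) ^ d * K * FTsq T Bf p := by
        refine mul_le_mul_of_nonneg_left ?_ (by positivity)
        refine setIntegral_mono_on (integrable_finsetSum _ fun τ _ => hgi τ) hmaj measurableSet_BZ fun p hp => ?_
        simp only [hg]
        exact integrand_sum_le_of_fibre n ha hK T Bf p hp
    _ = ((n : ℝ) + 1) ^ d * K * ∑ y ∈ T, Bf y ^ 2 := by
        rw [integral_const_mul, integral_FTsq]
        have h2π : ((2 * π) ^ d : ℝ) ≠ 0 := by positivity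
        field_simp

/-- **THE PARAMETRIC CHAIN**: a fibre bound `Σ_τ‖G_τ(p)‖² ≤ (n+1)^d·K·symbR(p)²` on the zone gives
`Σ′_z (H B)(z)² ≤ (n+1)^d·K·Σ′_y B(y)²` for every square-summable `B` (exhaustion by finite windows as in (42)). [folklore] -/
theorem tsum_HBZd_sq_le_of_fibre (n : ℕ) {a : ℝ} (ha : 0 < a) {K : ℝ} (hK0 : 0 ≤ K)
    (hK : ∀ p ∈ BZ d, ∑ τ : Fin d → Fin (n + 1), ‖G (n + 1) a 0 τ (ofRealVec p)‖ ^ 2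
      ≤ ((n : ℝ) + 1) ^ d * K * symbR (n + 1) a p ^ 2)
    (Bf : X d → ℝ) (hB : Summable fun x => Bf x ^ 2) :
    ∑' z : X d, HBZd n a Bf z ^ 2 ≤ ((n : ℝ) + 1) ^ d * K * ∑' y : X d, Bf y ^ 2 := by
  set C : ℝ := ((n : ℝ) + 1) ^ d * K with hC
  have hC0 : 0 ≤ C := by positivity
  have hW : ∀ W : Finset (X d), ∑ z ∈ W, HBZd n a Bf z ^ 2 ≤ C * ∑' y : X d, Bf y ^ 2 := by
    intro W
    refine le_of_tendsto (tendsto_sum_HB_sq n ha hB W) (Filter.Eventually.of_forall fun T => ?_)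
    have hT := tsum_HB_sq_le_of_fibre n ha hK T Bf
    calc ∑ z ∈ W, HB n a T Bf z ^ 2 ≤ ∑' z : X d, HB n a T Bf z ^ 2 :=
          hT.1.sum_le_tsum W fun z _ => sq_nonneg _
      _ ≤ C * ∑ y ∈ T, Bf y ^ 2 := hT.2
      _ ≤ C * ∑' y : X d, Bf y ^ 2 :=
          mul_le_mul_of_nonneg_left (hB.sum_le_tsum T fun y _ => sq_nonneg _) hC0
  exact Real.tsum_le_of_sum_le (fun z => sq_nonneg _) hW

end

end Summit.QuantumFields.BalabanUV.T4Continuum.NE7b.OneShotChartFibreChain
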